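import Literature.MathematicalPhysics.QuantumFieldTheory.Balaban1983to89.B1Eq324BenfattoClassSectEMemberPrecisionDoorOnLambdaStar
import Literature.MathematicalPhysics.QuantumFieldTheory.Balaban1983to89.B1Eq324BenfattoClassSectEMemberERowsAtNode00StarSmall

/-!
# `Balaban1983to89.B1Eq324BenfattoClassSectEMemberPrecisionDoorOnLambdaStarSmall` — THE (3.24) PRECISION DOOR OF RECORD AT NODE 00's STAR SECT. E LETTERS,
# GENERAL **SMALL** BACKGROUND: every NODE-00-side row a theorem (seat dag-n08-b g38, INTENT-24; node N08 [Balaban1985UV3], row `h324c`)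

statement-level companion of published sources with citation tags; every declaration here is a theorem; nothing here is a claim about the
Yang–Mills mass gap

T. Bałaban, *Ultraviolet stability of three-dimensional lattice pure gauge field theories*, Commun. Math. Phys. **102** (1985) 255–275 [Balaban1985UV3], (24) p. 262;
*Propagators for lattice gauge theories in a background field*, CMP **99** (1985) 389–434 [Balaban1985BackgroundPropagators] (= [B9]), Sect. E (3.155)–(3.158)
pp. 427–428, (3.132) p. 422, (3.35)–(3.36) p. 396, Thm 3.12 p. 423; *Propagators … II*, CMP **96** (1984) 223–250 [Balaban1984PropagatorsII] (= [4]), (2.3) p. 224,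
Lemma 2.4 p. 245, (2.149) p. 249, (2.153)–(2.156) pp. 249–250; *Averaging operations for lattice gauge theories*, CMP **98** (1985) 17–51 [Balaban1985Averaging] (= [5]),
(125)–(126) p. 36; *(Higgs)₂,₃ quantum fields in a finite volume. I*, CMP **85** (1982) 603–636 [Balaban1982Higgs1], (3.24) p. 616; G. Benfatto et al., CMP **59** (1978)
143–166 [BenfattoEtAl1978], Lemma (4.5)–(4.7) p. 152.

THE PRINTED LOCUS.  [B9] p. 428: *«(CB)(b₀) is equal to a solution of the equation (QB)(c) = 0 considered as an equation on the variable B(b₀)»* — for a SMALL averaged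
field `V` the pivot coefficient `K_c(V)` of that equation is `L^{−(d+1)}(id + O(|V − 1|))`, a unit ([5] (126) p. 36: `|(Q(V₀)A)_c| ≤ (1 + O(1)L²α₀)α₁`); [4] (2.3) p. 224 ∕
Lemma 2.4 p. 245: «Λ also a set of bonds b such that at least one of the end-points b₋, b₊ belongs to Λ» (the STAR variables and constraints).

WHY THIS FILE.  p702005 `…PrecisionDoorOnLambdaStar` §4 `eq324_CsDeltaCPstY_sectEStYOfRecordV7_trBasis_of_units_onΛst_on_unit` is the (3.24) precision door OF RECORD
at NODE 00's STAR letters for a GENERAL background `U`: NODE 00's own rows (locality ∕ column mass of `C_st(V)` modulo a pivot-inverse row, unitarity of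
`V = avYOfRecord x U`, (R3′), the transfer of the `γ₀` row) DISCHARGED, and DISPLAYED in star currency: [5]'s reality `IsSymmTr ((𝔯 x).Δ2 U) ∕ IsSymmTr ((𝔢₀ x).D2J U)`,
node N06's (3.132) P-row and the 𝒥-row on STAR pairs, the STAR PIVOT UNITS `IsUnit (KstY …) ∕ IsUnit (KTstY …)` + the pivot-inverse row `‖K_c(V)⁻¹a‖ ≤ κ_K L^{d+1}‖a‖`,
and the Δ_k-row `γ₀` on the `V`-constrained STAR subspace.  Seat dag-n08-d g39 then proved the three STAR-PIVOT rows in the SMALL-FIELD regime of the averaged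
field (`Node00.OpsYSectEElimStarSmall`: `isUnit_KstY_of_smallVY ∕ isUnit_KTstY_of_smallVY`; `…ERowsAtNode00StarSmall`: `norm_inverse_KstY_apply_le_of_smallVY`
with `κ_K := (1 − κ)⁻¹`, `κ := L^{d+1}·2δ_V(L + (d+1)ℓ) < 1`) and named the `_of_small` corollary of §4 as the door owner's (their HANDOFF §g39, (t133)).
THIS FILE is that corollary, in the three currencies the lineage keeps for the P-row:
* §1 ★★★ `eq324_CsDeltaCPstY_sectEStYOfRecordV7_trBasis_of_small_onΛst_on_unit` — §4 with the three star-pivot rows DISCHARGED under «`G ≤ U(N)`, `G`-valued `U`,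
  `‖(avYOfRecord x U)(b) − 1‖ ≤ δ_V` on every unit bond, `L^{d+1}·2δ_V(L + (d+1)ℓ) < 1`» (`Node00.OpsYSectEElimSmall.smallVY_avYOfRecord`).  EVERY NODE-00-side row
  of the door is now a theorem at a general small background; DISPLAYED (all node N06's ∕ [5]'s): the two reality rows, the P-row and the 𝒥-row on STAR pairs,
  the Δ_k-row `γ₀` ([B9] p. 428 «localizing … methods of Sect. B», G-B9-09).
* §2 ★★★ `…_of_ineq3132_of_small_onΛst_on_unit` — the P-row := node N06's NUMBERED ROW 26 at the background `U`, `B9.Ineq3132 (d+1)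
  ((opsYNuOfRecordV4E N θ M⋆ 𝔯 𝔢 𝔴 𝔈 x).QG1Qinv) B_P δ U` (the conjunct `B9Eq3132NuReading.s3132Nu_opsYNuOfRecordV4E` concludes), read on STAR pairs BY NAME
  through seat n08-d's top-level dictionary `…PRowDictionaryAtNode00.pRowOnΛst_opsYNuOfRecordV4E_of_ineq3132` (`ν(u)ν(v) = η^{d+1} = etaDY x` on top-level bonds).
* §3 ★★★ `…_of_stmt3132Printed_of_small_onΛst_on_unit` — THE FAMILY FORM: hypothesis = the conclusion TYPE of n06-i's `s3132Nu_opsYNuOfRecordV4E`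
  (`B9.Stmt3132Printed (d+1) c35 geo9Y (bg9Y SU(N)) (…QGQinv) (…QG1Qinv)`), which yields print's thresholds `M₄`, `a₀` and ONE rate `δ` for the whole Stage-3′ family;
  then for every member above `M₄`, every `α₀` with `Mα₀ ≤ a₀`, every background in print's classes (3.35)–(3.36) (`Reg335 ∕ Reg336` of `bg9Y SU(N)`; so `U` is
  `SU(N)`-valued, `B9BackgroundsKLevelV1.mem_of_reg335`) whose averaged field of record is `δ_V`-small, the door of §2 with the P-row DISCHARGED family-wide
  (n08-d `pRowOnΛst_family_opsYNuOfRecordV4E`'s road).  DISPLAYED: the small averaged field, [5]'s reality, the 𝒥-row on STAR pairs at the rate `δ`, the Δ_k-row.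
* `small_regime_nonvacuous` — the smallness numeral holds at `δ_V = 0` (the regime contains `U = 1`: `avYOfRecord_one`, n08-d's `smallVY_avYOfRecord_one`).

HONEST SCOPE.  Count-neutral Literature theorems; typed compositions of landed pieces (no new estimate).  The SMALL FIELD of the averaged field of record
(`‖V(b) − 1‖ ≤ δ_V` on ALL unit bonds) is a displayed regime CRUDER than print's (3.35) (small CURVATURE): print reduces (3.35) to a small field by the axial gauge of
[5] (55), (109) and the gauge covariance of `K_c`; at a STAR corner with only `c₊` good the tree's `Q(V)` carries no comb transport inside `B(c₋)` and is not gauge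
covariant there (`Node00.OpsYSectEElimStarSmall` margin (i), seat n08-d's recorded dead end), so no `PlaqSmall`-keyed star edition of p680757 §1 is claimed.  What
stays DISPLAYED is node N06's ∕ [5]'s: the reality of `Δ⁽²⁾(U)`, `⟨D̃⁽²⁾·,J⟩(U)`; the (3.132) P-row (§1) resp. its row-26 statement (§2) resp. N06's four Λ-normalised
binders behind `s3132Nu_opsYNuOfRecordV4E` (§3); the 𝒥-row on STAR pairs (print's (3.136) route — seat n08-d's `…JRowCompositionAtNode00` is keyed to SOURCE pairs
`inΛY`; its star re-key is theirs); the Δ_k-row `γ₀` at `U ≠ 1` (G-B9-09; at `U = 1` it is this lineage's theorem `…PrecisionDoorAtOneStar` §3 and the whole door is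
`…PrecisionDoorAtOneStarAssembled`).  The IDENT for row `h324c` (NODE 00's pin `(𝔖 k).μ = 𝒩(0, 𝕄_Λ̃st(η^{d+1}C_st\*Δ_kC_st)⁻¹).map Φ`, box, class-II letters, window
`b₁ < b₀`) is NOT made; `avYOfRecord` is def-Y's declared dictionary for `V = U_k`; nothing of [Balaban1985UV3] ∕ [B9] ∕ [4] ∕ [5] ∕ [Balaban1982Higgs1] ∕
[BenfattoEtAl1978] is asserted beyond what the tree proves; node N06 ∕ N08 NOT discharged; nothing about `d = 4` specifically, the continuum, OS axioms, a mass gap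
or Clay.
-/

noncomputable section

open MeasureTheory Finset Matrix
open scoped Matrix.Norms.L2Operator

namespace Literature.MathematicalPhysics.QuantumFieldTheory.Balaban1983to89.B1Eq324BenfattoClassSectEMemberPrecisionDoorOnLambdaStarSmall

open Literature.MathematicalPhysics.QuantumFieldTheory
open Literature.MathematicalPhysics.QuantumFieldTheory.Balaban1983to89.B1Eq324BenfattoLemma
open Literature.MathematicalPhysics.QuantumFieldTheory.Balaban1983to89.Node00
open B9PinMembersKLevelV1 (MemberY geo9Y bg9Y)
open B9PinGeometryKLevelV1 (unitDistY)
open B9Thm311ReadingCoords (trIP IsSymmTr)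
open B9CoReadingCoordsTranspose (trReForm TrIdx trBasis)
open B7Prop2Explicit (unitaryUnits)
open B7Prop2SpecialUnitary (specialUnitaryUnits specialUnitaryUnits_le_unitaryUnits)
open B9Eq3132NuReading (opsYNuOfRecordV4E)
open B1Eq324BenfattoClassSectEMemberPRowDictionaryAtNode00 (pRowOnΛst_opsYNuOfRecordV4E_of_ineq3132)
open B1Eq324BenfattoClassSectEMemberPrecisionDoorOnLambdaStar (eq324_CsDeltaCPstY_sectEStYOfRecordV7_trBasis_of_units_onΛst_on_unit)
open B1Eq324BenfattoClassSectEMemberERowsAtNode00StarSmall (norm_inverse_KstY_apply_le_of_smallVY)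

/-! ## §1  The door of record at the STAR letters, general SMALL background: the three star-pivot rows discharged -/

section DoorSmall

/-- ★★★ **THE (3.24) PRECISION DOOR OF RECORD AT NODE 00's STAR LETTERS, GENERAL SMALL BACKGROUND `U` — EVERY NODE-00-SIDE ROW A THEOREM.**
p702005 §4 `eq324_CsDeltaCPstY_sectEStYOfRecordV7_trBasis_of_units_onΛst_on_unit` (v4 letters of record `lettersYOfRecordV4 N θ M⋆ 𝔯 x`, v7 STAR Sect. E record
`sectEStYOfRecordV7 N θ M⋆ 𝔢₀ x`, averaged field of record `V = avYOfRecord x U`, print units `etaDY x = η^{d+1}`; conclusion (3.24) for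
`𝒩(0, 𝕄_ι(CsDeltaCPstY x (lettersYOfRecordV4 …) (sectEStYOfRecordV7 …) U)⁻¹)`) with its three STAR-PIVOT rows — `IsUnit (KstY x V U c)`, `IsUnit (KTstY x V U c)` at every
star corner and the pivot-inverse row `‖K_c(V)⁻¹a‖ ≤ κ_K·L^{d+1}·‖a‖` — DISCHARGED in the SMALL-FIELD regime of the averaged field of record: `G ≤ U(N)`, `G`-valued `U`,
`‖V(b) − 1‖ ≤ δ_V` on every unit bond, `κ := L^{d+1}·2δ_V(L + (d+1)ℓ) < 1` (seat n08-d's `Node00.OpsYSectEElimStarSmall.isUnit_K[T]stY_of_smallVY` and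
`…ERowsAtNode00StarSmall.norm_inverse_KstY_apply_le_of_smallVY`, `κ_K := (1 − κ)⁻¹`; the `SmallVY` witness is def-Y's `OpsYSectEElimSmall.smallVY_avYOfRecord`).
DISPLAYED (node N06's ∕ [5]'s rows, star currency, each a theorem at `U = 1`): `IsSymmTr ((𝔯 x).Δ2 U)`, `IsSymmTr ((𝔢₀ x).D2J U)`, the (3.132) P-row and the 𝒥-row
between STAR bonds (`inΛstY`), the Δ_k-row `γ₀` on print's `V`-constrained STAR subspace «`B = 0` off `inΛstY`, on the axial trees, `(Q(V)B)(c) = 0` at every star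
corner».
[cite: Balaban1985BackgroundPropagators, (3.35) p.396, (3.132) p.422, (3.155)–(3.158) pp.427–428, Thm 3.11 p.416; Balaban1985Averaging, (125)–(126) p.36;
Balaban1984PropagatorsII, (2.3) p.224, Lemma 2.4 p.245, (2.153)–(2.156) pp.249–250; Balaban1985UV3, (24) p.262, pp.271–272; Balaban1982Higgs1, (3.24) p.616;
BenfattoEtAl1978, Lemma (4.5)–(4.7) p.152 (class form; bent window, presentation and coordinates ours)] -/
theorem eq324_CsDeltaCPstY_sectEStYOfRecordV7_trBasis_of_small_onΛst_on_unit (N : ℕ) [NeZero N] (θ : Stage3Params) (Mstar : ℕ)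
    (𝔯 : ResY N θ Mstar) (𝔢₀ : SectEY N θ Mstar) {γ₀ BP KJ δ δV : ℝ} (hγ₀ : 0 < γ₀) (hBP : 0 ≤ BP) (hKJ : 0 ≤ KJ) (hδ : 0 < δ) (hδV : 0 ≤ δV)
    (hsmall : (((θ.ℓ₆ + 1 : ℕ) : ℝ)) ^ (θ.d₆ + 1) * (2 * δV * (((θ.ℓ₆ + 1 : ℕ) + (θ.d₆ + 1) * θ.ℓ₆ : ℕ) : ℝ)) < 1)
    (t D : ℕ) {ϰ : ℝ} (hϰ : 0 < ϰ) {p₀ σ' c κ' : ℝ} (hp₀ : 2 / 3 < p₀) (hσ : 0 < σ') (hc : 0 ≤ c) (hκ : 0 < κ') (hκσ : κ' < σ' * (t + 1)) :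
    ∃ b₁ : ℝ, ∀ b₀ : ℝ, b₁ < b₀ → ∃ C : ℝ, 0 ≤ C ∧ ∀ η : ℝ, 0 < η → η ≤ 1 →
      ∀ (x : MemberY θ.d₆ θ.ℓ₆ θ.hd' θ.hL' θ.b₀ θ.b₁ Mstar) [DecidableEq (IBondY x.toKIdx)]
        {G : Subgroup (Matrix (Fin N) (Fin N) ℂ)ˣ}, G ≤ unitaryUnits (Matrix (Fin N) (Fin N) ℂ) →
      ∀ (U : CfgY (Matrix (Fin N) (Fin N) ℂ) x.toKIdx), (∀ μ z, U μ z ∈ G) →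
        (∀ b : UBondY x, ‖((avYOfRecord x U b : (Matrix (Fin N) (Fin N) ℂ)ˣ) : Matrix (Fin N) (Fin N) ℂ) - 1‖ ≤ δV) →
        IsSymmTr (fun _ => (1 : ℝ)) ((𝔯 x).Δ2 U) → IsSymmTr (fun _ => (1 : ℝ)) ((𝔢₀ x).D2J U) →
      ∀ {σ : Type} [Fintype σ] [DecidableEq σ] [Nonempty σ] (ι : σ → IBondY x.toKIdx), Function.Injective ι → (∀ s, lamTstY x (ι s)) →
        (∀ u v : IBondY x.toKIdx, inΛstY x u → inΛstY x v →
          (⨆ E : BallY (Matrix (Fin N) (Fin N) ℂ), ‖(((etaDY x : ℝ) : ℂ) • (lettersYOfRecordV4 N θ Mstar 𝔯 x).QG1Qinv U)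
              (deltaY v (E : Matrix (Fin N) (Fin N) ℂ)) u‖) ≤ BP * Real.exp (-(δ * unitDistY x u v))) →
        (∀ (u v : IBondY x.toKIdx) (E : Matrix (Fin N) (Fin N) ℂ), inΛstY x u → inΛstY x v →
          ‖((((etaDY x : ℝ) : ℂ) • (aY x.toKIdx + (𝔢₀ x).D2J U)).restrictScalars ℝ) (Pi.single v E) u‖ ≤ KJ * ‖E‖ * Real.exp (-(δ * unitDistY x u v))) →
        (∀ B : IBondY x.toKIdx → Matrix (Fin N) (Fin N) ℂ, (∀ q, ¬ inΛstY x q → B q = 0) → (∀ q, IsAxialY x q → B q = 0) →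
          (∀ c' : CBondStY x, Q1Y x (avYOfRecord x) U c'.1 B = 0) →
          γ₀ * trIP (fun _ => (1 : ℝ)) B B ≤
            trIP (fun _ => (1 : ℝ)) B (deltaKPstY x (lettersYOfRecordV4 N θ Mstar 𝔯 x) (sectEStYOfRecordV7 N θ Mstar 𝔢₀ x) U B)) →
      ∃ (Λ : Finset (B1Eq324BenfattoLemma.Site (θ.d₆ + 1 + (θ.d₆ + 1) + 1))) (e' : σ × TrIdx N ≃ ↥Λ),
        ((gaussianFieldOfKernel fun u w => if h : u ∈ Λ ∧ w ∈ Λ then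
            ((Matrix.reindex e' e'
              (Matrix.of fun p q : σ × TrIdx N =>
                  trReForm (trBasis N p.2) (((CsDeltaCPstY x (lettersYOfRecordV4 N θ Mstar 𝔯 x)
            (sectEStYOfRecordV7 N θ Mstar 𝔢₀ x) U).restrictScalars ℝ)
                    (Pi.single (ι q.1) (trBasis N q.2)) (ι p.1))))⁻¹ :
                Matrix ↥Λ ↥Λ ℝ) ⟨u, h.1⟩ ⟨w, h.2⟩ else 0).map
            (fun (z : B1Eq324BenfattoLemma.Site (θ.d₆ + 1 + (θ.d₆ + 1) + 1) → ℝ) (q : σ × TrIdx N) => z ((e' q : ↥Λ) : B1Eq324BenfattoLemma.Site (θ.d₆ + 1 + (θ.d₆ + 1) + 1))) =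
          gaussianFieldOfKernel fun p q =>
            ((Matrix.of fun p q : σ × TrIdx N =>
                trReForm (trBasis N p.2) (((CsDeltaCPstY x (lettersYOfRecordV4 N θ Mstar 𝔯 x)
            (sectEStYOfRecordV7 N θ Mstar 𝔢₀ x) U).restrictScalars ℝ)
                  (Pi.single (ι q.1) (trBasis N q.2)) (ι p.1)))⁻¹ :
              Matrix (σ × TrIdx N) (σ × TrIdx N) ℝ) p q) ∧
        (∀ p : ℝ, 0 ≤ p →
          ((fun (z : B1Eq324BenfattoLemma.Site (θ.d₆ + 1 + (θ.d₆ + 1) + 1) → ℝ) (q : σ × TrIdx N) => z ((e' q : ↥Λ) : B1Eq324BenfattoLemma.Site (θ.d₆ + 1 + (θ.d₆ + 1) + 1))) ⁻¹'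
              {ω : σ × TrIdx N → ℝ | ∀ q, |ω q| ≤ p}) =ᵐ[gaussianFieldOfKernel fun u w => if h : u ∈ Λ ∧ w ∈ Λ then
                ((Matrix.reindex e' e'
                  (Matrix.of fun p q : σ × TrIdx N =>
                      trReForm (trBasis N p.2) (((CsDeltaCPstY x (lettersYOfRecordV4 N θ Mstar 𝔯 x)
            (sectEStYOfRecordV7 N θ Mstar 𝔢₀ x) U).restrictScalars ℝ)
                        (Pi.single (ι q.1) (trBasis N q.2)) (ι p.1))))⁻¹ :
                    Matrix ↥Λ ↥Λ ℝ) ⟨u, h.1⟩ ⟨w, h.2⟩ else 0]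
            smallFieldSet Λ p) ∧
        ∀ (s : ℕ) (I J : Finset (B1Eq324BenfattoLemma.Site (θ.d₆ + 1 + (θ.d₆ + 1) + 1))) (𝔞 : Coef (θ.d₆ + 1 + (θ.d₆ + 1) + 1)),
          I.Nonempty → J ⊆ I → J ⊆ Λ → coefSup s D 𝔞 J ≤ c * η ^ σ' →
          0 < ∫ z, cutoffBoltzmann (hamiltonian s D ϰ 𝔞 J) I (B10.pFun b₀ p₀ η) z ∂(gaussianFieldOfKernel fun u w => if h : u ∈ Λ ∧ w ∈ Λ then
              ((Matrix.reindex e' e'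
                (Matrix.of fun p q : σ × TrIdx N =>
                    trReForm (trBasis N p.2) (((CsDeltaCPstY x (lettersYOfRecordV4 N θ Mstar 𝔯 x)
            (sectEStYOfRecordV7 N θ Mstar 𝔢₀ x) U).restrictScalars ℝ)
                      (Pi.single (ι q.1) (trBasis N q.2)) (ι p.1))))⁻¹ :
                  Matrix ↥Λ ↥Λ ℝ) ⟨u, h.1⟩ ⟨w, h.2⟩ else 0) ∧
            |Real.log (∫ z, cutoffBoltzmann (hamiltonian s D ϰ 𝔞 J) I (B10.pFun b₀ p₀ η) z ∂(gaussianFieldOfKernel fun u w =>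
                if h : u ∈ Λ ∧ w ∈ Λ then
                  ((Matrix.reindex e' e'
                    (Matrix.of fun p q : σ × TrIdx N =>
                        trReForm (trBasis N p.2) (((CsDeltaCPstY x (lettersYOfRecordV4 N θ Mstar 𝔯 x)
            (sectEStYOfRecordV7 N θ Mstar 𝔢₀ x) U).restrictScalars ℝ)
                          (Pi.single (ι q.1) (trBasis N q.2)) (ι p.1))))⁻¹ :
                      Matrix ↥Λ ↥Λ ℝ) ⟨u, h.1⟩ ⟨w, h.2⟩ else 0)) -
              cumulantSum (gaussianFieldOfKernel fun u w => if h : u ∈ Λ ∧ w ∈ Λ then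
                  ((Matrix.reindex e' e'
                    (Matrix.of fun p q : σ × TrIdx N =>
                        trReForm (trBasis N p.2) (((CsDeltaCPstY x (lettersYOfRecordV4 N θ Mstar 𝔯 x)
            (sectEStYOfRecordV7 N θ Mstar 𝔢₀ x) U).restrictScalars ℝ)
                          (Pi.single (ι q.1) (trBasis N q.2)) (ι p.1))))⁻¹ :
                      Matrix ↥Λ ↥Λ ℝ) ⟨u, h.1⟩ ⟨w, h.2⟩ else 0)
                (hamiltonian s D ϰ 𝔞 J) t| ≤ C * η ^ κ' * I.card := by
  -- `κ_K := (1 − κ)⁻¹ ≥ 0` from the smallness numeral; then §4 of p702005 with n08-d's three small-field rows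
  have hκK : (0 : ℝ) ≤ (1 - (((θ.ℓ₆ + 1 : ℕ) : ℝ)) ^ (θ.d₆ + 1) * (2 * δV * (((θ.ℓ₆ + 1 : ℕ) + (θ.d₆ + 1) * θ.ℓ₆ : ℕ) : ℝ)))⁻¹ :=
    inv_nonneg.2 (sub_nonneg.2 hsmall.le)
  obtain ⟨b₁, hb₁⟩ := eq324_CsDeltaCPstY_sectEStYOfRecordV7_trBasis_of_units_onΛst_on_unit N θ Mstar 𝔯 𝔢₀ hγ₀ hBP hKJ hδ hκK t D hϰ
    hp₀ hσ hc hκ hκσ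
  refine ⟨b₁, fun b₀ hb₀ => ?_⟩
  obtain ⟨C, hC, hE⟩ := hb₁ b₀ hb₀
  refine ⟨C, hC, ?_⟩
  intro η hη hηle x _ G hG U hU hV hΔ2 hD2J σ _ _ _ ι hι hιT hProw hJker hco
  have hsm : SmallVY x (avYOfRecord x) G U δV := smallVY_avYOfRecord N θ Mstar x hG hU hδV hV hsmall
  exact hE η hη hηle x hG U hU hΔ2 hD2J ι hι hιT hProw hJker (isUnit_KstY_of_smallVY x _ hsm) (isUnit_KTstY_of_smallVY x _ hsm)
    (norm_inverse_KstY_apply_le_of_smallVY x _ hsm) hco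

/-- the SMALL regime of §1 is inhabited for every block size and dimension: its numeral holds at `δ_V = 0`, the case of the trivial background
(`avYOfRecord_one`: `V(1) = 1`; n08-d's `OpsYSectEElimSmall.smallVY_avYOfRecord_one`). [cite: Balaban1985BackgroundPropagators, (3.35) p.396, Cor. 3.5 p.407 («for U = 1»), bookkeeping] -/
theorem small_regime_nonvacuous (θ : Stage3Params) :
    (((θ.ℓ₆ + 1 : ℕ) : ℝ)) ^ (θ.d₆ + 1) * (2 * (0 : ℝ) * (((θ.ℓ₆ + 1 : ℕ) + (θ.d₆ + 1) * θ.ℓ₆ : ℕ) : ℝ)) < 1 := by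
  rw [mul_zero, zero_mul, mul_zero]; exact zero_lt_one

end DoorSmall

/-! ## §2  The P-row BY NAME, per background: node N06's numbered row 26 (`B9.Ineq3132` for the `ν`-read `(QG₁Q*)⁻¹` of record) on STAR pairs -/

section PRowByName

/-- ★★★ **THE STAR DOOR OF RECORD, GENERAL SMALL BACKGROUND, WITH ITS P-ROW BY NAME** — §1 with the displayed (R2′a) on STAR pairs REPLACED by node N06's numbered row 26
at the background `U`: [B9] (3.132) for the `ν`-weighted reading of `(QG₁Q*)⁻¹(U)` at n06-i's repaired instance of record, `B9.Ineq3132 (d+1)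
((opsYNuOfRecordV4E N θ M⋆ 𝔯 𝔢 𝔴 𝔈 x).QG1Qinv) B_P δ U` (the second conjunct of `B9.Stmt3132Printed` that `B9Eq3132NuReading.s3132Nu_opsYNuOfRecordV4E` concludes; any
Sect.-E ∕ walk ∕ exponent families `𝔢 𝔴 𝔈` — the field `QG1Qinv` does not see them, `opsYNuOfRecordV4E_QG1Qinv`), read on STAR pairs (top level, at least one end block
good) through seat n08-d's dictionary `pRowOnΛst_opsYNuOfRecordV4E_of_ineq3132` (`ν(u)ν(v) = η^{d+1}`, `Lᵏη·len = 1`, `|y − y′| ≤ d(y, y′)`; its scale token is `etaDY x` by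
`rfl`).  Displayed otherwise as in §1: the small averaged field, [5]'s reality, the 𝒥-row on STAR pairs, the Δ_k-row `γ₀`.
[cite: Balaban1985BackgroundPropagators, (3.132) p.422, Thm 3.12 p.423, (3.35) p.396, (3.155)–(3.158) pp.427–428; Balaban1984PropagatorsII, (2.149) p.249, (2.3) p.224,
Lemma 2.4 p.245; Balaban1985Averaging, (125)–(126) p.36; Balaban1985UV3, (24) p.262, pp.271–272; Balaban1982Higgs1, (3.24) p.616; BenfattoEtAl1978, Lemma (4.5)–(4.7)
p.152 (class form; bent window, presentation and coordinates ours)] -/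
theorem eq324_CsDeltaCPstY_sectEStYOfRecordV7_trBasis_of_ineq3132_of_small_onΛst_on_unit (N : ℕ) [NeZero N] (θ : Stage3Params) (Mstar : ℕ)
    (𝔯 : ResY N θ Mstar) (𝔢₀ 𝔢 : SectEY N θ Mstar) (𝔴 : RWEY N θ Mstar) (𝔈 : ExpsY N θ Mstar) {γ₀ BP KJ δ δV : ℝ} (hγ₀ : 0 < γ₀) (hBP : 0 ≤ BP)
    (hKJ : 0 ≤ KJ) (hδ : 0 < δ) (hδV : 0 ≤ δV)
    (hsmall : (((θ.ℓ₆ + 1 : ℕ) : ℝ)) ^ (θ.d₆ + 1) * (2 * δV * (((θ.ℓ₆ + 1 : ℕ) + (θ.d₆ + 1) * θ.ℓ₆ : ℕ) : ℝ)) < 1)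
    (t D : ℕ) {ϰ : ℝ} (hϰ : 0 < ϰ) {p₀ σ' c κ' : ℝ} (hp₀ : 2 / 3 < p₀) (hσ : 0 < σ') (hc : 0 ≤ c) (hκ : 0 < κ') (hκσ : κ' < σ' * (t + 1)) :
    ∃ b₁ : ℝ, ∀ b₀ : ℝ, b₁ < b₀ → ∃ C : ℝ, 0 ≤ C ∧ ∀ η : ℝ, 0 < η → η ≤ 1 →
      ∀ (x : MemberY θ.d₆ θ.ℓ₆ θ.hd' θ.hL' θ.b₀ θ.b₁ Mstar) [DecidableEq (IBondY x.toKIdx)]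
        {G : Subgroup (Matrix (Fin N) (Fin N) ℂ)ˣ}, G ≤ unitaryUnits (Matrix (Fin N) (Fin N) ℂ) →
      ∀ (U : CfgY (Matrix (Fin N) (Fin N) ℂ) x.toKIdx), (∀ μ z, U μ z ∈ G) →
        (∀ b : UBondY x, ‖((avYOfRecord x U b : (Matrix (Fin N) (Fin N) ℂ)ˣ) : Matrix (Fin N) (Fin N) ℂ) - 1‖ ≤ δV) →
        IsSymmTr (fun _ => (1 : ℝ)) ((𝔯 x).Δ2 U) → IsSymmTr (fun _ => (1 : ℝ)) ((𝔢₀ x).D2J U) →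
      ∀ {σ : Type} [Fintype σ] [DecidableEq σ] [Nonempty σ] (ι : σ → IBondY x.toKIdx), Function.Injective ι → (∀ s, lamTstY x (ι s)) →
        B9.Ineq3132 (θ.d₆ + 1) (opsYNuOfRecordV4E N θ Mstar 𝔯 𝔢 𝔴 𝔈 x).QG1Qinv BP δ U →
        (∀ (u v : IBondY x.toKIdx) (E : Matrix (Fin N) (Fin N) ℂ), inΛstY x u → inΛstY x v →
          ‖((((etaDY x : ℝ) : ℂ) • (aY x.toKIdx + (𝔢₀ x).D2J U)).restrictScalars ℝ) (Pi.single v E) u‖ ≤ KJ * ‖E‖ * Real.exp (-(δ * unitDistY x u v))) →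
        (∀ B : IBondY x.toKIdx → Matrix (Fin N) (Fin N) ℂ, (∀ q, ¬ inΛstY x q → B q = 0) → (∀ q, IsAxialY x q → B q = 0) →
          (∀ c' : CBondStY x, Q1Y x (avYOfRecord x) U c'.1 B = 0) →
          γ₀ * trIP (fun _ => (1 : ℝ)) B B ≤
            trIP (fun _ => (1 : ℝ)) B (deltaKPstY x (lettersYOfRecordV4 N θ Mstar 𝔯 x) (sectEStYOfRecordV7 N θ Mstar 𝔢₀ x) U B)) →
      ∃ (Λ : Finset (B1Eq324BenfattoLemma.Site (θ.d₆ + 1 + (θ.d₆ + 1) + 1))) (e' : σ × TrIdx N ≃ ↥Λ),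
        ((gaussianFieldOfKernel fun u w => if h : u ∈ Λ ∧ w ∈ Λ then
            ((Matrix.reindex e' e'
              (Matrix.of fun p q : σ × TrIdx N =>
                  trReForm (trBasis N p.2) (((CsDeltaCPstY x (lettersYOfRecordV4 N θ Mstar 𝔯 x)
            (sectEStYOfRecordV7 N θ Mstar 𝔢₀ x) U).restrictScalars ℝ)
                    (Pi.single (ι q.1) (trBasis N q.2)) (ι p.1))))⁻¹ :
                Matrix ↥Λ ↥Λ ℝ) ⟨u, h.1⟩ ⟨w, h.2⟩ else 0).map
            (fun (z : B1Eq324BenfattoLemma.Site (θ.d₆ + 1 + (θ.d₆ + 1) + 1) → ℝ) (q : σ × TrIdx N) => z ((e' q : ↥Λ) : B1Eq324BenfattoLemma.Site (θ.d₆ + 1 + (θ.d₆ + 1) + 1))) =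
          gaussianFieldOfKernel fun p q =>
            ((Matrix.of fun p q : σ × TrIdx N =>
                trReForm (trBasis N p.2) (((CsDeltaCPstY x (lettersYOfRecordV4 N θ Mstar 𝔯 x)
            (sectEStYOfRecordV7 N θ Mstar 𝔢₀ x) U).restrictScalars ℝ)
                  (Pi.single (ι q.1) (trBasis N q.2)) (ι p.1)))⁻¹ :
              Matrix (σ × TrIdx N) (σ × TrIdx N) ℝ) p q) ∧
        (∀ p : ℝ, 0 ≤ p →
          ((fun (z : B1Eq324BenfattoLemma.Site (θ.d₆ + 1 + (θ.d₆ + 1) + 1) → ℝ) (q : σ × TrIdx N) => z ((e' q : ↥Λ) : B1Eq324BenfattoLemma.Site (θ.d₆ + 1 + (θ.d₆ + 1) + 1))) ⁻¹'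
              {ω : σ × TrIdx N → ℝ | ∀ q, |ω q| ≤ p}) =ᵐ[gaussianFieldOfKernel fun u w => if h : u ∈ Λ ∧ w ∈ Λ then
                ((Matrix.reindex e' e'
                  (Matrix.of fun p q : σ × TrIdx N =>
                      trReForm (trBasis N p.2) (((CsDeltaCPstY x (lettersYOfRecordV4 N θ Mstar 𝔯 x)
            (sectEStYOfRecordV7 N θ Mstar 𝔢₀ x) U).restrictScalars ℝ)
                        (Pi.single (ι q.1) (trBasis N q.2)) (ι p.1))))⁻¹ :
                    Matrix ↥Λ ↥Λ ℝ) ⟨u, h.1⟩ ⟨w, h.2⟩ else 0]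
            smallFieldSet Λ p) ∧
        ∀ (s : ℕ) (I J : Finset (B1Eq324BenfattoLemma.Site (θ.d₆ + 1 + (θ.d₆ + 1) + 1))) (𝔞 : Coef (θ.d₆ + 1 + (θ.d₆ + 1) + 1)),
          I.Nonempty → J ⊆ I → J ⊆ Λ → coefSup s D 𝔞 J ≤ c * η ^ σ' →
          0 < ∫ z, cutoffBoltzmann (hamiltonian s D ϰ 𝔞 J) I (B10.pFun b₀ p₀ η) z ∂(gaussianFieldOfKernel fun u w => if h : u ∈ Λ ∧ w ∈ Λ then
              ((Matrix.reindex e' e'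
                (Matrix.of fun p q : σ × TrIdx N =>
                    trReForm (trBasis N p.2) (((CsDeltaCPstY x (lettersYOfRecordV4 N θ Mstar 𝔯 x)
            (sectEStYOfRecordV7 N θ Mstar 𝔢₀ x) U).restrictScalars ℝ)
                      (Pi.single (ι q.1) (trBasis N q.2)) (ι p.1))))⁻¹ :
                  Matrix ↥Λ ↥Λ ℝ) ⟨u, h.1⟩ ⟨w, h.2⟩ else 0) ∧
            |Real.log (∫ z, cutoffBoltzmann (hamiltonian s D ϰ 𝔞 J) I (B10.pFun b₀ p₀ η) z ∂(gaussianFieldOfKernel fun u w =>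
                if h : u ∈ Λ ∧ w ∈ Λ then
                  ((Matrix.reindex e' e'
                    (Matrix.of fun p q : σ × TrIdx N =>
                        trReForm (trBasis N p.2) (((CsDeltaCPstY x (lettersYOfRecordV4 N θ Mstar 𝔯 x)
            (sectEStYOfRecordV7 N θ Mstar 𝔢₀ x) U).restrictScalars ℝ)
                          (Pi.single (ι q.1) (trBasis N q.2)) (ι p.1))))⁻¹ :
                      Matrix ↥Λ ↥Λ ℝ) ⟨u, h.1⟩ ⟨w, h.2⟩ else 0)) -
              cumulantSum (gaussianFieldOfKernel fun u w => if h : u ∈ Λ ∧ w ∈ Λ then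
                  ((Matrix.reindex e' e'
                    (Matrix.of fun p q : σ × TrIdx N =>
                        trReForm (trBasis N p.2) (((CsDeltaCPstY x (lettersYOfRecordV4 N θ Mstar 𝔯 x)
            (sectEStYOfRecordV7 N θ Mstar 𝔢₀ x) U).restrictScalars ℝ)
                          (Pi.single (ι q.1) (trBasis N q.2)) (ι p.1))))⁻¹ :
                      Matrix ↥Λ ↥Λ ℝ) ⟨u, h.1⟩ ⟨w, h.2⟩ else 0)
                (hamiltonian s D ϰ 𝔞 J) t| ≤ C * η ^ κ' * I.card := by
  obtain ⟨b₁, hb₁⟩ := eq324_CsDeltaCPstY_sectEStYOfRecordV7_trBasis_of_small_onΛst_on_unit N θ Mstar 𝔯 𝔢₀ hγ₀ hBP hKJ hδ hδV hsmall t D hϰ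
    hp₀ hσ hc hκ hκσ
  refine ⟨b₁, fun b₀ hb₀ => ?_⟩
  obtain ⟨C, hC, hE⟩ := hb₁ b₀ hb₀
  refine ⟨C, hC, ?_⟩
  intro η hη hηle x _ G hG U hU hV hΔ2 hD2J σ _ _ _ ι hι hιT h3132 hJker hco
  exact hE η hη hηle x hG U hU hV hΔ2 hD2J ι hι hιT
    (fun u v hu hv => pRowOnΛst_opsYNuOfRecordV4E_of_ineq3132 θ Mstar 𝔯 𝔢 𝔴 𝔈 x (θ.d₆ + 1) hBP hδ.le U h3132 hu hv) hJker hco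

end PRowByName

/-! ## §3  THE FAMILY FORM over node N06's row 26 (`B9.Stmt3132Printed` at the `ν`-read record): print's thresholds and ONE rate for the whole Stage-3′ family -/

section Family

/-- ★★★ **THE STAR DOOR OF RECORD, FAMILY FORM OVER NODE N06's ROW 26, SMALL AVERAGED FIELD** — the conclusion TYPE of n06-i's
`B9Eq3132NuReading.s3132Nu_opsYNuOfRecordV4E` (`B9.Stmt3132Printed (d+1) c35 geo9Y (bg9Y SU(N)) (…QGQinv) (…QG1Qinv)` at the `ν`-read record over `𝔯`) taken VERBATIM as
the hypothesis: it yields print's thresholds `M₄`, `a₀` and ONE rate `δ` (and one `B_P`) for the whole Stage-3′ family, and then, for every member above `M₄`, every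
`α₀` with `Mα₀ ≤ a₀` and every background in print's classes (3.35)–(3.36) (`Reg335 ∕ Reg336` of `bg9Y SU(N)` — so `U` is `SU(N)`-valued,
`B9BackgroundsKLevelV1.mem_of_reg335`, and `SU(N) ≤ U(N)`) whose averaged field of record is `δ_V`-small, the door of §2 with the P-row DISCHARGED.  DISPLAYED: the small
averaged field (numeral `L^{d+1}·2δ_V(L + (d+1)ℓ) < 1`), [5]'s reality of `Δ⁽²⁾(U)`, `⟨D̃⁽²⁾·,J⟩(U)`, the 𝒥-row on STAR pairs at the rate `δ`, the Δ_k-row `γ₀` (R5′).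
[cite: Balaban1985BackgroundPropagators, (3.132) p.422, Thm 3.12 p.423, (3.35)–(3.36) p.396, p.427, (3.155)–(3.158) p.428; Balaban1984PropagatorsII, (2.149) p.249,
(2.3) p.224, Lemma 2.4 p.245; Balaban1985Averaging, (125)–(126) p.36; Balaban1985UV3, (24) p.262, pp.271–272; Balaban1982Higgs1, (3.24) p.616; BenfattoEtAl1978,
Lemma (4.5)–(4.7) p.152 (class form; bent window, presentation and coordinates ours)] -/
theorem eq324_CsDeltaCPstY_sectEStYOfRecordV7_trBasis_of_stmt3132Printed_of_small_onΛst_on_unit (N : ℕ) [NeZero N] (θ : Stage3Params) (Mstar : ℕ)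
    (𝔯 : ResY N θ Mstar) (𝔢₀ 𝔢 : SectEY N θ Mstar) (𝔴 : RWEY N θ Mstar) (𝔈 : ExpsY N θ Mstar) {c35 : ℝ}
    (h26 : B9.Stmt3132Printed (θ.d₆ + 1) c35
      (geo9Y (d := θ.d₆) (ℓ := θ.ℓ₆) (hd := θ.hd') (hL := θ.hL') (b₀ := θ.b₀) (b₁ := θ.b₁) (Mstar := Mstar))
      (bg9Y (Matrix (Fin N) (Fin N) ℂ) (specialUnitaryUnits (Fin N)))
      (fun x => (opsYNuOfRecordV4E N θ Mstar 𝔯 𝔢 𝔴 𝔈 x).QGQinv)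
      (fun x => (opsYNuOfRecordV4E N θ Mstar 𝔯 𝔢 𝔴 𝔈 x).QG1Qinv))
    {γ₀ KJ δV : ℝ} (hγ₀ : 0 < γ₀) (hKJ : 0 ≤ KJ) (hδV : 0 ≤ δV)
    (hsmall : (((θ.ℓ₆ + 1 : ℕ) : ℝ)) ^ (θ.d₆ + 1) * (2 * δV * (((θ.ℓ₆ + 1 : ℕ) + (θ.d₆ + 1) * θ.ℓ₆ : ℕ) : ℝ)) < 1)
    (t D : ℕ) {ϰ : ℝ} (hϰ : 0 < ϰ) {p₀ σ' c κ' : ℝ} (hp₀ : 2 / 3 < p₀) (hσ : 0 < σ') (hc : 0 ≤ c) (hκ : 0 < κ') (hκσ : κ' < σ' * (t + 1)) :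
    ∃ M₄ δ a₀ : ℝ, 0 < M₄ ∧ 0 < δ ∧ 0 < a₀ ∧ ∃ b₁ : ℝ, ∀ b₀ : ℝ, b₁ < b₀ → ∃ C : ℝ, 0 ≤ C ∧ ∀ η : ℝ, 0 < η → η ≤ 1 →
      ∀ (x : MemberY θ.d₆ θ.ℓ₆ θ.hd' θ.hL' θ.b₀ θ.b₁ Mstar) [DecidableEq (IBondY x.toKIdx)], M₄ ≤ (geo9Y x).M →
      ∀ α₀ : ℝ, 0 < α₀ → (geo9Y x).M * α₀ ≤ a₀ →
      ∀ (U : CfgY (Matrix (Fin N) (Fin N) ℂ) x.toKIdx),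
        (bg9Y (Matrix (Fin N) (Fin N) ℂ) (specialUnitaryUnits (Fin N)) x).Reg335 c35 α₀ U →
        (bg9Y (Matrix (Fin N) (Fin N) ℂ) (specialUnitaryUnits (Fin N)) x).Reg336 c35 α₀ U →
        (∀ b : UBondY x, ‖((avYOfRecord x U b : (Matrix (Fin N) (Fin N) ℂ)ˣ) : Matrix (Fin N) (Fin N) ℂ) - 1‖ ≤ δV) →
        IsSymmTr (fun _ => (1 : ℝ)) ((𝔯 x).Δ2 U) → IsSymmTr (fun _ => (1 : ℝ)) ((𝔢₀ x).D2J U) →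
      ∀ {σ : Type} [Fintype σ] [DecidableEq σ] [Nonempty σ] (ι : σ → IBondY x.toKIdx), Function.Injective ι → (∀ s, lamTstY x (ι s)) →
        (∀ (u v : IBondY x.toKIdx) (E : Matrix (Fin N) (Fin N) ℂ), inΛstY x u → inΛstY x v →
          ‖((((etaDY x : ℝ) : ℂ) • (aY x.toKIdx + (𝔢₀ x).D2J U)).restrictScalars ℝ) (Pi.single v E) u‖ ≤ KJ * ‖E‖ * Real.exp (-(δ * unitDistY x u v))) →
        (∀ B : IBondY x.toKIdx → Matrix (Fin N) (Fin N) ℂ, (∀ q, ¬ inΛstY x q → B q = 0) → (∀ q, IsAxialY x q → B q = 0) →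
          (∀ c' : CBondStY x, Q1Y x (avYOfRecord x) U c'.1 B = 0) →
          γ₀ * trIP (fun _ => (1 : ℝ)) B B ≤
            trIP (fun _ => (1 : ℝ)) B (deltaKPstY x (lettersYOfRecordV4 N θ Mstar 𝔯 x) (sectEStYOfRecordV7 N θ Mstar 𝔢₀ x) U B)) →
      ∃ (Λ : Finset (B1Eq324BenfattoLemma.Site (θ.d₆ + 1 + (θ.d₆ + 1) + 1))) (e' : σ × TrIdx N ≃ ↥Λ),
        ((gaussianFieldOfKernel fun u w => if h : u ∈ Λ ∧ w ∈ Λ then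
            ((Matrix.reindex e' e'
              (Matrix.of fun p q : σ × TrIdx N =>
                  trReForm (trBasis N p.2) (((CsDeltaCPstY x (lettersYOfRecordV4 N θ Mstar 𝔯 x)
            (sectEStYOfRecordV7 N θ Mstar 𝔢₀ x) U).restrictScalars ℝ)
                    (Pi.single (ι q.1) (trBasis N q.2)) (ι p.1))))⁻¹ :
                Matrix ↥Λ ↥Λ ℝ) ⟨u, h.1⟩ ⟨w, h.2⟩ else 0).map
            (fun (z : B1Eq324BenfattoLemma.Site (θ.d₆ + 1 + (θ.d₆ + 1) + 1) → ℝ) (q : σ × TrIdx N) => z ((e' q : ↥Λ) : B1Eq324BenfattoLemma.Site (θ.d₆ + 1 + (θ.d₆ + 1) + 1))) =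
          gaussianFieldOfKernel fun p q =>
            ((Matrix.of fun p q : σ × TrIdx N =>
                trReForm (trBasis N p.2) (((CsDeltaCPstY x (lettersYOfRecordV4 N θ Mstar 𝔯 x)
            (sectEStYOfRecordV7 N θ Mstar 𝔢₀ x) U).restrictScalars ℝ)
                  (Pi.single (ι q.1) (trBasis N q.2)) (ι p.1)))⁻¹ :
              Matrix (σ × TrIdx N) (σ × TrIdx N) ℝ) p q) ∧
        (∀ p : ℝ, 0 ≤ p →
          ((fun (z : B1Eq324BenfattoLemma.Site (θ.d₆ + 1 + (θ.d₆ + 1) + 1) → ℝ) (q : σ × TrIdx N) => z ((e' q : ↥Λ) : B1Eq324BenfattoLemma.Site (θ.d₆ + 1 + (θ.d₆ + 1) + 1))) ⁻¹'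
              {ω : σ × TrIdx N → ℝ | ∀ q, |ω q| ≤ p}) =ᵐ[gaussianFieldOfKernel fun u w => if h : u ∈ Λ ∧ w ∈ Λ then
                ((Matrix.reindex e' e'
                  (Matrix.of fun p q : σ × TrIdx N =>
                      trReForm (trBasis N p.2) (((CsDeltaCPstY x (lettersYOfRecordV4 N θ Mstar 𝔯 x)
            (sectEStYOfRecordV7 N θ Mstar 𝔢₀ x) U).restrictScalars ℝ)
                        (Pi.single (ι q.1) (trBasis N q.2)) (ι p.1))))⁻¹ :
                    Matrix ↥Λ ↥Λ ℝ) ⟨u, h.1⟩ ⟨w, h.2⟩ else 0]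
            smallFieldSet Λ p) ∧
        ∀ (s : ℕ) (I J : Finset (B1Eq324BenfattoLemma.Site (θ.d₆ + 1 + (θ.d₆ + 1) + 1))) (𝔞 : Coef (θ.d₆ + 1 + (θ.d₆ + 1) + 1)),
          I.Nonempty → J ⊆ I → J ⊆ Λ → coefSup s D 𝔞 J ≤ c * η ^ σ' →
          0 < ∫ z, cutoffBoltzmann (hamiltonian s D ϰ 𝔞 J) I (B10.pFun b₀ p₀ η) z ∂(gaussianFieldOfKernel fun u w => if h : u ∈ Λ ∧ w ∈ Λ then
              ((Matrix.reindex e' e'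
                (Matrix.of fun p q : σ × TrIdx N =>
                    trReForm (trBasis N p.2) (((CsDeltaCPstY x (lettersYOfRecordV4 N θ Mstar 𝔯 x)
            (sectEStYOfRecordV7 N θ Mstar 𝔢₀ x) U).restrictScalars ℝ)
                      (Pi.single (ι q.1) (trBasis N q.2)) (ι p.1))))⁻¹ :
                  Matrix ↥Λ ↥Λ ℝ) ⟨u, h.1⟩ ⟨w, h.2⟩ else 0) ∧
            |Real.log (∫ z, cutoffBoltzmann (hamiltonian s D ϰ 𝔞 J) I (B10.pFun b₀ p₀ η) z ∂(gaussianFieldOfKernel fun u w =>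
                if h : u ∈ Λ ∧ w ∈ Λ then
                  ((Matrix.reindex e' e'
                    (Matrix.of fun p q : σ × TrIdx N =>
                        trReForm (trBasis N p.2) (((CsDeltaCPstY x (lettersYOfRecordV4 N θ Mstar 𝔯 x)
            (sectEStYOfRecordV7 N θ Mstar 𝔢₀ x) U).restrictScalars ℝ)
                          (Pi.single (ι q.1) (trBasis N q.2)) (ι p.1))))⁻¹ :
                      Matrix ↥Λ ↥Λ ℝ) ⟨u, h.1⟩ ⟨w, h.2⟩ else 0)) -
              cumulantSum (gaussianFieldOfKernel fun u w => if h : u ∈ Λ ∧ w ∈ Λ then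
                  ((Matrix.reindex e' e'
                    (Matrix.of fun p q : σ × TrIdx N =>
                        trReForm (trBasis N p.2) (((CsDeltaCPstY x (lettersYOfRecordV4 N θ Mstar 𝔯 x)
            (sectEStYOfRecordV7 N θ Mstar 𝔢₀ x) U).restrictScalars ℝ)
                          (Pi.single (ι q.1) (trBasis N q.2)) (ι p.1))))⁻¹ :
                      Matrix ↥Λ ↥Λ ℝ) ⟨u, h.1⟩ ⟨w, h.2⟩ else 0)
                (hamiltonian s D ϰ 𝔞 J) t| ≤ C * η ^ κ' * I.card := by
  obtain ⟨M₄, δ, a₀, BP, hM₄, hδ, ha₀, hBP, H⟩ := h26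
  obtain ⟨b₁, hb₁⟩ := eq324_CsDeltaCPstY_sectEStYOfRecordV7_trBasis_of_ineq3132_of_small_onΛst_on_unit N θ Mstar 𝔯 𝔢₀ 𝔢 𝔴 𝔈 hγ₀ hBP.le
    hKJ hδ hδV hsmall t D hϰ hp₀ hσ hc hκ hκσ
  refine ⟨M₄, δ, a₀, hM₄, hδ, ha₀, b₁, fun b₀ hb₀ => ?_⟩
  obtain ⟨C, hC, hE⟩ := hb₁ b₀ hb₀
  refine ⟨C, hC, ?_⟩
  intro η hη hηle x _ hMx α₀ hα₀ hMa U h335 h336 hV hΔ2 hD2J σ _ _ _ ι hι hιT hJker hco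
  exact hE η hη hηle x specialUnitaryUnits_le_unitaryUnits U (B9BackgroundsKLevelV1.mem_of_reg335 x.toKIdx h335.1) hV hΔ2 hD2J ι hι hιT
    (H x hMx α₀ hα₀ hMa U h335 h336).2 hJker hco

end Family

end Literature.MathematicalPhysics.QuantumFieldTheory.Balaban1983to89.B1Eq324BenfattoClassSectEMemberPrecisionDoorOnLambdaStarSmall

end
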